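import Summits.BirchSwinnertonDyer.BirchSwinnertonDyer.Theorems.ManinLocalTwoThreeBoundaryHeckeOperators
import Literature.NumberTheory.EllipticCurves.Gamma0CocycleDegeneracyMaps
import Mathlib.NumberTheory.LSeries.PrimesInAP
import Mathlib.LinearAlgebra.Eigenspace.Triangularizable
import HarnessLib

/-!
# E-es-30 `BoundaryEisenstein`: the boundary symbols of `Γ₀(M)` are Eisenstein (generalised-eigen form)

Summit `BirchSwinnertonDyer`, route `ManinLocalTwoThree` (cell bsd-f2-manin), cruxes C2 `ManinOddAtFour`
(stmt-BirchSwinnertonDyer-22967, deciding) / C3 `ManinPrimeToThreeAtNine` (stmt-BirchSwinnertonDyer-22968).  Both generation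
stubs of the active skeleton lines reduce (p3: `Theorems/ManinLocalTwoThreeGenerationOfRelativeIhara*.lean`) to the relative
Ihara statement `Summit.BirchSwinnertonDyer.Rank1Residual.ManinAdditive.RelativeIharaShiftVanishingBar`; in the planner's proof of
the latter (MEMO-es §22.2–§22.3, §23 «BOTTOM») the discrepancy `D := Φ∘A_t^n − Φ` of the lifted cusp symbol is a BOUNDARY
symbol of level `t^n L` lying in the `λ`-generalised eigenspace of the Hecke operators, and it must vanish because «the cusp
module of `Γ₀(M)` is Eisenstein» (E-es-30) while `λ` is not.  This file proves E-es-30 in exactly that form: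

**`boundaryEisenstein`.**  `M ≥ 1`, `K` an algebraically closed field, `S` a finite set of naturals containing the primes
of `M`, `λ : ℕ → K`.  If a boundary symbol `Φ ∈ boundaryOf K (cuspInvariants M K)` (i.e. `Φ(a,b) = w(b) − w(a)` with `w`
`Γ₀(M)`-invariant on `P¹(ℚ)`) lies in the generalised `λ(r)`-eigenspace of `symbolHecke M r K` for every prime `r ∉ S`, and
`λ` is NOT a weight-`2` Eisenstein system (`¬ IsEisensteinEigensystem 2 λ`: no Dirichlet characters `ψ, φ` with
`λ(r) = ψ(r) + r φ(r)` off a finite set), then `Φ = 0`.  Function form: `boundaryEisenstein_cuspFun` (a `Γ₀(M)`-invariant `w`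
with `(T_r − λ(r))^k w` constant for all primes `r ∉ S` is constant).

Proof (MEMO-es §22.3, made effective): on boundary symbols `T_r = A_r + r A_r⁻¹` with `r ↦ A_r` an action of `(ℤ/M)^×`
commuting with every `T_q` (`Theorems/ManinLocalTwoThreeBoundaryHeckeOperators.lean`); the `λ`-generalised part `E` of the
(finite-dimensional) boundary symbols is `A`-stable, so if `E ≠ 0` the commuting family `A` has a common eigenvector
`v ∈ E` (`exists_common_eigenvector`: minimal `A`-stable subspace + one eigenvalue, `K` algebraically closed), `A_r v = χ_r v`,
`T_r v = (χ_r + r χ_r⁻¹) v`, and `v` generalised `λ(r)`-eigen forces `λ(r) = χ_r + r χ_r⁻¹`; finally `r ↦ χ_r` depends on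
`r mod M` and is multiplicative, so by Dirichlet's theorem on primes in arithmetic progressions (Mathlib
`Nat.forall_exists_prime_gt_and_eq_mod`, used to name every unit class by a prime) it is the restriction of a Dirichlet
character `ψ` mod `M`, and `λ(r) = ψ(r) + r ψ⁻¹(r)` for all primes `r ∉ S` — Eisenstein, contradiction.

This is the es planner's candidate E-es-30 (`EsG10.BoundaryEisenstein L`, HOME/es/Sketch-es-g10.lean §3, there over an ad-hoc
`Cusp := Option ℚ`) in Mathlib's `OnePoint ℚ` vocabulary and in the GENERALISED-eigen form that §23 needs at level `t^n L`.
No new definitions; nothing about BSD or Manin's conjecture is proved here.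

References: G. Stevens, *Arithmetic on modular curves*, Progr. Math. 20 (1982), Ch. 1–2 and Thm. 1.3.5 (boundary /
Eisenstein); F. Diamond, J. Shurman, GTM 228, Prop. 3.8.3, §5.2, Prop. 5.2.3 [cite: DiamondShurman2005, Prop. 5.2.3 (p. 173)];
G. Shimura (1971) §8.3; cell memo HOME/MEMO-es.md §22.3, §23.
-/

set_option autoImplicit false
set_option linter.dupNamespace false

open scoped MatrixGroups

open CongruenceSubgroup Matrix.SpecialLinearGroup Literature.NumberTheory.EllipticCurves.ModularForms

namespace Summit.BirchSwinnertonDyer.BirchSwinnertonDyer.Theorems.ManinLocalTwoThree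

/-! ### A commuting family on a finite-dimensional stable subspace has a common eigenvector -/

section CommonEigenvector

/-- **Common eigenvector of a commuting family** (`K` algebraically closed): if `U ≠ 0` is a finite-dimensional subspace
stable under the endomorphisms `f i`, which commute on `U`, then some `v ∈ U`, `v ≠ 0`, is an eigenvector of every `f i`.
Proof: a nonzero stable subspace `W ≤ U` of minimal dimension; for each `i`, `f i|_W` has an eigenvalue `c` and
`W ∩ ker(f i − c)` is nonzero and stable, hence all of `W`. [folklore] -/
theorem exists_common_eigenvector {K V : Type*} [Field K] [IsAlgClosed K] [AddCommGroup V] [Module K V] {ι : Type*}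
    (f : ι → Module.End K V) (U : Submodule K V) [FiniteDimensional K U] (hU : U ≠ ⊥)
    (hstab : ∀ i, ∀ v ∈ U, f i v ∈ U) (hcomm : ∀ i j, ∀ v ∈ U, f i (f j v) = f j (f i v)) :
    ∃ v ∈ U, v ≠ 0 ∧ ∀ i, ∃ c : K, f i v = c • v := by
  classical
  let P : ℕ → Prop := fun n ↦ ∃ W : Submodule K V, W ≤ U ∧ W ≠ ⊥ ∧ (∀ i, ∀ v ∈ W, f i v ∈ W) ∧
    Module.finrank K W = n
  have hP : ∃ n, P n := ⟨_, U, le_rfl, hU, hstab, rfl⟩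
  obtain ⟨W, hWU, hW0, hWst, hWdim⟩ := Nat.find_spec hP
  have hmin : ∀ W' : Submodule K V, W' ≤ U → W' ≠ ⊥ → (∀ i, ∀ v ∈ W', f i v ∈ W') →
      Module.finrank K W ≤ Module.finrank K W' := by
    intro W' h1 h2 h3
    rw [hWdim]
    exact Nat.find_min' hP ⟨W', h1, h2, h3, rfl⟩
  haveI : FiniteDimensional K W := Submodule.finiteDimensional_of_le hWU
  have hscalar : ∀ i, ∃ c : K, ∀ v ∈ W, f i v = c • v := by
    intro i
    haveI : Nontrivial W := Submodule.nontrivial_iff_ne_bot.mpr hW0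
    let g : Module.End K W := (f i).restrict (fun v hv ↦ hWst i v hv)
    obtain ⟨c, hc⟩ := Module.End.exists_eigenvalue g
    obtain ⟨w, hw⟩ := hc.exists_hasEigenvector
    have hw_eq : f i (w : V) = c • (w : V) := by
      have h1 : g w = c • w := Module.End.mem_eigenspace_iff.mp hw.1
      have h2 := congrArg Subtype.val h1
      simpa [g, LinearMap.restrict_apply] using h2
    let W₁ : Submodule K V := W ⊓ LinearMap.ker (f i - c • LinearMap.id)
    have hmem : ∀ v, v ∈ W₁ ↔ v ∈ W ∧ f i v = c • v := by
      intro v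
      simp only [W₁, Submodule.mem_inf, LinearMap.mem_ker, LinearMap.sub_apply, LinearMap.smul_apply,
        LinearMap.id_apply, sub_eq_zero]
    have hW₁W : W₁ ≤ W := inf_le_left
    have hW₁0 : W₁ ≠ ⊥ := by
      rw [Submodule.ne_bot_iff]
      exact ⟨(w : V), (hmem _).mpr ⟨w.2, hw_eq⟩, fun h ↦ hw.2 (Subtype.ext h)⟩
    have hW₁st : ∀ j, ∀ v ∈ W₁, f j v ∈ W₁ := by
      intro j v hv
      obtain ⟨hvW, hfv⟩ := (hmem v).mp hv
      refine (hmem _).mpr ⟨hWst j v hvW, ?_⟩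
      rw [hcomm i j v (hWU hvW), hfv, map_smul]
    have hle := hmin W₁ (hW₁W.trans hWU) hW₁0 hW₁st
    have heq : W₁ = W := Submodule.eq_of_le_of_finrank_le hW₁W hle
    refine ⟨c, fun v hv ↦ ?_⟩
    have hv₁ : v ∈ W₁ := heq ▸ hv
    exact ((hmem v).mp hv₁).2
  obtain ⟨v, hvW, hv0⟩ := Submodule.exists_mem_ne_zero_of_ne_bot hW0
  refine ⟨v, hWU hvW, hv0, fun i ↦ ?_⟩
  obtain ⟨c, hc⟩ := hscalar i
  exact ⟨c, hc v hvW⟩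

end CommonEigenvector

/-! ### Congruences from equalities in `ZMod M` (plumbing) -/

section ZModPlumbing

/-- `(a : ZMod M) = b` for naturals gives `M ∣ a − b` in `ℤ`. [folklore] -/
theorem int_dvd_sub_of_natCast_eq {M a b : ℕ} (h : (a : ZMod M) = (b : ZMod M)) : (M : ℤ) ∣ (a : ℤ) - b := by
  have h' : ((b : ℤ) : ZMod M) = ((a : ℤ) : ZMod M) := by push_cast; exact h.symm
  exact (ZMod.intCast_eq_intCast_iff_dvd_sub _ _ _).mp h'

end ZModPlumbing

/-! ### E-es-30 -/

section Main

variable (M : ℕ) [NeZero M] {K : Type*} [Field K] [IsAlgClosed K]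

/-- **E-es-30 `BoundaryEisenstein` (generalised-eigen, symbol form).**  Let `S ⊇` primes of `M` and `λ : ℕ → K` with `K`
algebraically closed.  A boundary symbol of level `M` (`Φ = boundaryOf K w`, `w ∈ cuspInvariants M K`) that lies in the
generalised `λ(r)`-eigenspace of `symbolHecke M r K` for every prime `r ∉ S` vanishes, unless `λ` is a weight-`2` Eisenstein
system `ψ(r) + r φ(r)`.  (MEMO-es §22.3: on the cusp classes `T_r = σ_r + r σ_r⁻¹`, so the systems occurring are
`χ(r) + r χ⁻¹(r)`, `χ` a Dirichlet character mod `M`.) [cite: DiamondShurman2005, Prop. 5.2.3 (p. 173)] -/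
theorem boundaryEisenstein (S : Finset ℕ) (hS : ∀ q : ℕ, q.Prime → q ∣ M → q ∈ S) (lam : ℕ → K)
    (Φ : OnePoint ℚ → OnePoint ℚ → K) (hΦ : Φ ∈ (cuspInvariants M K).map (boundaryOf K))
    (heig : ∀ (r : ℕ) [NeZero r], r.Prime → r ∉ S → Φ ∈ Module.End.maxGenEigenspace (symbolHecke M r K) (lam r))
    (hne : ¬ IsEisensteinEigensystem 2 lam) : Φ = 0 := by
  classical
  by_contra hΦ0
  apply hne
  -- primes not dividing `M` index the shift operators `A_q`
  let ι := {q : ℕ // q.Prime ∧ ¬ q ∣ M}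
  haveI hnz : ∀ i : ι, NeZero i.1 := fun i ↦ ⟨i.2.1.ne_zero⟩
  let A : ι → Module.End K (OnePoint ℚ → OnePoint ℚ → K) := fun i ↦ symbolShift K (heckeNbrInfty i.2.1)
  -- primes outside `S` index the generalised-eigen conditions
  let ιS := {r : ℕ // r.Prime ∧ r ∉ S}
  have hιS : ∀ r : ιS, ¬ r.1 ∣ M := fun r h ↦ r.2.2 (hS r.1 r.2.1 h)
  haveI hnzS : ∀ r : ιS, NeZero r.1 := fun r ↦ ⟨r.2.1.ne_zero⟩
  let BV : Submodule K (OnePoint ℚ → OnePoint ℚ → K) := (cuspInvariants M K).map (boundaryOf K)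
  let E : Submodule K (OnePoint ℚ → OnePoint ℚ → K) :=
    BV ⊓ ⨅ r : ιS, Module.End.maxGenEigenspace (symbolHecke M r.1 K) (lam r.1)
  have hΦE : Φ ∈ E := by
    refine Submodule.mem_inf.mpr ⟨hΦ, ?_⟩
    rw [Submodule.mem_iInf]
    intro r
    exact heig r.1 r.2.1 r.2.2
  have hE0 : E ≠ ⊥ := fun h ↦ hΦ0 ((Submodule.eq_bot_iff _).mp h Φ hΦE)
  haveI : FiniteDimensional K (cuspInvariants M K) := finiteDimensional_cuspInvariants M K
  haveI : FiniteDimensional K BV := inferInstance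
  haveI : FiniteDimensional K E := Submodule.finiteDimensional_of_le (inf_le_left : E ≤ BV)
  have hEB : ∀ Ψ ∈ E, Ψ ∈ BV := fun Ψ hΨ ↦ (Submodule.mem_inf.mp hΨ).1
  have hEst : ∀ i : ι, ∀ Ψ ∈ E, A i Ψ ∈ E := by
    intro i Ψ hΨ
    obtain ⟨hΨB, hΨg⟩ := Submodule.mem_inf.mp hΨ
    rw [Submodule.mem_iInf] at hΨg
    refine Submodule.mem_inf.mpr ⟨symbolShift_heckeNbrInfty_mem M i.2.1 i.2.2 hΨB, ?_⟩
    rw [Submodule.mem_iInf]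
    intro r
    exact symbolShift_mem_maxGenEigenspace M r.2.1 i.2.1 (hιS r) i.2.2 hΨB (hΨg r)
  have hEcomm : ∀ i j : ι, ∀ Ψ ∈ E, A i (A j Ψ) = A j (A i Ψ) := by
    intro i j Ψ hΨ
    exact symbolShift_infty_comm M j.2.1 i.2.1 j.2.2 i.2.2 (hEB Ψ hΨ)
  -- a common eigenvector of the `A_q` in `E`
  obtain ⟨v, hvE, hv0, hev⟩ := exists_common_eigenvector A E hE0 hEst hEcomm
  choose χ hχ using hev
  have hvB : v ∈ BV := hEB v hvE
  have hAv : ∀ i : ι, symbolShift K (heckeNbrInfty i.2.1) v = χ i • v := fun i ↦ hχ i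
  have hχne : ∀ i : ι, χ i ≠ 0 := by
    intro i hzero
    have h1 := symbolShift_zero_infty M i.2.1 i.2.2 hvB
    rw [hAv i, hzero, zero_smul, map_zero] at h1
    exact hv0 h1.symm
  have hBv : ∀ i : ι, symbolShift K (heckeNbrZero i.2.1) v = (χ i)⁻¹ • v := by
    intro i
    have h1 := symbolShift_zero_infty M i.2.1 i.2.2 hvB
    rw [hAv i, map_smul] at h1
    calc symbolShift K (heckeNbrZero i.2.1) v
        = (χ i)⁻¹ • (χ i • symbolShift K (heckeNbrZero i.2.1) v) := by
          rw [smul_smul, inv_mul_cancel₀ (hχne i), one_smul]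
      _ = (χ i)⁻¹ • v := by rw [h1]
  -- equal scalars from equal multiples of `v`
  have hinj : ∀ {c c' : K}, c • v = c' • v → c = c' := fun h ↦ smul_left_injective K hv0 h
  -- `λ(r) = χ_r + r χ_r⁻¹` for every prime `r ∉ S`
  have hlam : ∀ (r : ℕ) (hr : r.Prime) (hrS : r ∉ S),
      lam r = χ ⟨r, hr, fun h ↦ hrS (hS r hr h)⟩ + (r : K) * (χ ⟨r, hr, fun h ↦ hrS (hS r hr h)⟩)⁻¹ := by
    intro r hr hrS
    have hrM : ¬ r ∣ M := fun h ↦ hrS (hS r hr h)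
    haveI : NeZero r := ⟨hr.ne_zero⟩
    set i : ι := ⟨r, hr, hrM⟩ with hi
    set μ : K := χ i + (r : K) * (χ i)⁻¹ with hμ
    have hT : symbolHecke M r K v = μ • v := by
      rw [symbolHecke_eq_shift_of_mem M hr hrM hvB, hAv i, hBv i, smul_smul, ← add_smul]
    have hgen : v ∈ Module.End.maxGenEigenspace (symbolHecke M r K) (lam r) := by
      have h := (Submodule.mem_inf.mp hvE).2
      rw [Submodule.mem_iInf] at h
      exact h ⟨r, hr, hrS⟩
    rw [Module.End.mem_maxGenEigenspace] at hgen
    obtain ⟨k, hk⟩ := hgen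
    have hpow : ∀ n : ℕ, ((symbolHecke M r K - lam r • 1) ^ n) v = ((μ - lam r) ^ n) • v := by
      intro n
      induction n with
      | zero => simp
      | succ n ih =>
        rw [pow_succ, Module.End.mul_apply, LinearMap.sub_apply, LinearMap.smul_apply, Module.End.one_apply, hT,
          ← sub_smul, map_smul, ih, smul_smul, ← pow_succ']
    rw [hpow k] at hk
    have hzero : (μ - lam r) ^ k = 0 := by
      rcases smul_eq_zero.mp hk with h | h
      · exact h
      · exact absurd h hv0
    have hml : μ - lam r = 0 := (pow_eq_zero_iff'.mp hzero).1
    rw [sub_eq_zero] at hml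
    rw [← hml]
  -- a prime in every unit class mod `M` (Dirichlet), never dividing `M`
  have hq : ∀ u : (ZMod M)ˣ, ∃ p : ℕ, p.Prime ∧ (p : ZMod M) = u := fun u ↦ by
    obtain ⟨p, -, hp, hpu⟩ := Nat.forall_exists_prime_gt_and_eq_mod u.isUnit 0
    exact ⟨p, hp, hpu⟩
  choose qf hqf_prime hqf_eq using hq
  have hqf_not_dvd : ∀ u : (ZMod M)ˣ, ¬ qf u ∣ M := by
    intro u hdvd
    have hu : IsUnit ((qf u : ℕ) : ZMod M) := by rw [hqf_eq u]; exact u.isUnit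
    exact ((ZMod.isUnit_prime_iff_not_dvd (hqf_prime u)).mp hu) hdvd
  haveI hqnz : ∀ u : (ZMod M)ˣ, NeZero (qf u) := fun u ↦ ⟨(hqf_prime u).ne_zero⟩
  let ιOf : (ZMod M)ˣ → ι := fun u ↦ ⟨qf u, hqf_prime u, hqf_not_dvd u⟩
  -- `χ` on unit classes is a homomorphism
  have hone : χ (ιOf 1) = 1 := by
    have hcong : (M : ℤ) ∣ (qf 1 : ℤ) - 1 := by
      have h := hqf_eq 1
      rw [Units.val_one, ← Nat.cast_one] at h
      exact int_dvd_sub_of_natCast_eq h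
    have h1 := symbolShift_infty_of_dvd_sub_one M (hqf_prime 1) (hqf_not_dvd 1) hcong hvB
    rw [hAv (ιOf 1)] at h1
    exact hinj (by rw [h1, one_smul])
  have hmul : ∀ u u' : (ZMod M)ˣ, χ (ιOf (u * u')) = χ (ιOf u) * χ (ιOf u') := by
    intro u u'
    have hcong : (M : ℤ) ∣ (qf u : ℤ) * (qf u') - qf (u * u') := by
      have h : ((qf u * qf u' : ℕ) : ZMod M) = (qf (u * u') : ZMod M) := by
        rw [Nat.cast_mul, hqf_eq u, hqf_eq u', hqf_eq (u * u'), Units.val_mul]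
      have h' := int_dvd_sub_of_natCast_eq h
      push_cast at h'
      exact h'
    have h1 := symbolShift_infty_mul_of_dvd M (hqf_prime u) (hqf_prime u') (hqf_prime (u * u')) (hqf_not_dvd u)
      (hqf_not_dvd u') (hqf_not_dvd (u * u')) hcong hvB
    rw [hAv (ιOf u), map_smul, hAv (ιOf u'), hAv (ιOf (u * u')), smul_smul] at h1
    exact (hinj h1).symm
  let ψu : (ZMod M)ˣ →* Kˣ :=
    { toFun := fun u ↦ Units.mk0 (χ (ιOf u)) (hχne _)
      map_one' := Units.ext (by simp only [Units.val_mk0, Units.val_one, hone])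
      map_mul' := fun u u' ↦ Units.ext (by simp only [Units.val_mk0, Units.val_mul, hmul]) }
  let ψ : DirichletCharacter K M := MulChar.ofUnitHom ψu
  -- `ψ(ℓ) = χ_ℓ` for primes `ℓ ∤ M`
  have hψ : ∀ (ℓ : ℕ) (hℓ : ℓ.Prime) (hℓM : ¬ ℓ ∣ M), ψ (ℓ : ZMod M) = χ ⟨ℓ, hℓ, hℓM⟩ := by
    intro ℓ hℓ hℓM
    let u : (ZMod M)ˣ := ZMod.unitOfCoprime ℓ ((Nat.Prime.coprime_iff_not_dvd hℓ).mpr hℓM)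
    have hu : (u : ZMod M) = (ℓ : ZMod M) := ZMod.coe_unitOfCoprime ℓ _
    rw [← hu, show ψ (u : ZMod M) = (ψu u : K) from MulChar.ofUnitHom_coe ψu u]
    show χ (ιOf u) = χ ⟨ℓ, hℓ, hℓM⟩
    have hcong : (M : ℤ) ∣ (qf u : ℤ) - ℓ := int_dvd_sub_of_natCast_eq (by rw [hqf_eq u, hu])
    haveI : NeZero ℓ := ⟨hℓ.ne_zero⟩
    have h1 := symbolShift_infty_congr M (hqf_prime u) hℓ (hqf_not_dvd u) hℓM hcong hvB
    rw [hAv (ιOf u), hAv ⟨ℓ, hℓ, hℓM⟩] at h1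
    exact hinj h1
  refine ⟨S, M, ψ, ψ⁻¹, Nat.pos_of_ne_zero (NeZero.ne M), fun ℓ hℓ hℓS ↦ ?_⟩
  have hℓM : ¬ ℓ ∣ M := fun h ↦ hℓS (hS ℓ hℓ h)
  rw [MulChar.inv_apply_eq_inv', hψ ℓ hℓ hℓM, hlam ℓ hℓ hℓS]
  norm_num

/-- **E-es-30, function form.**  A `Γ₀(M)`-invariant function `w` on `P¹(ℚ)` such that for every prime `r ∉ S` (`S ⊇`
primes of `M`) some power `(T_r − λ(r))^k w` is CONSTANT (i.e. `w` is generalised `λ`-eigen modulo constants), with `λ` not a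
weight-`2` Eisenstein system, is constant. [cite: DiamondShurman2005, Prop. 5.2.3 (p. 173)] -/
theorem boundaryEisenstein_cuspFun (S : Finset ℕ) (hS : ∀ q : ℕ, q.Prime → q ∣ M → q ∈ S) (lam : ℕ → K)
    (w : OnePoint ℚ → K) (hw : w ∈ cuspInvariants M K)
    (heig : ∀ (r : ℕ) [NeZero r], r.Prime → r ∉ S →
      ∃ (k : ℕ) (c : K), ((cuspFunHecke M r K - lam r • 1) ^ k) w = Function.const _ c)
    (hne : ¬ IsEisensteinEigensystem 2 lam) : ∃ c : K, w = Function.const _ c := by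
  have hΦ : boundaryOf K w ∈ (cuspInvariants M K).map (boundaryOf K) := Submodule.mem_map_of_mem hw
  -- `D ∘ (T − λ)^k = (T̂ − λ)^k ∘ D`
  have hcomm : ∀ (r : ℕ) [NeZero r] (k : ℕ) (u : OnePoint ℚ → K),
      ((symbolHecke M r K - lam r • 1) ^ k) (boundaryOf K u) = boundaryOf K (((cuspFunHecke M r K - lam r • 1) ^ k) u) := by
    intro r _ k
    induction k with
    | zero => intro u; simp
    | succ k ih =>
      intro u
      rw [pow_succ, pow_succ, Module.End.mul_apply, Module.End.mul_apply, ← ih]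
      congr 1
      funext a b
      simp only [LinearMap.sub_apply, LinearMap.smul_apply, Module.End.one_apply, Pi.sub_apply, Pi.smul_apply,
        symbolHecke_apply, boundaryOf_apply, cuspFunHecke_apply, smul_eq_mul, Finset.sum_sub_distrib]
      ring
  have hzero : boundaryOf K w = 0 := by
    refine boundaryEisenstein M S hS lam (boundaryOf K w) hΦ (fun r _ hr hrS ↦ ?_) hne
    rw [Module.End.mem_maxGenEigenspace]
    obtain ⟨k, c, hk⟩ := heig r hr hrS
    refine ⟨k, ?_⟩
    rw [hcomm r k w, hk]
    funext a b
    simp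
  refine ⟨w OnePoint.infty, funext fun x ↦ ?_⟩
  have h := congrFun (congrFun hzero OnePoint.infty) x
  simp only [boundaryOf_apply, Pi.zero_apply, sub_eq_zero] at h
  exact h

end Main

end Summit.BirchSwinnertonDyer.BirchSwinnertonDyer.Theorems.ManinLocalTwoThree
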